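import Summits.CriticalPhenomena.CardyFormulaZ2.Theorems.CardyComplexConeEdgePrecompactShiftStabilityReduction

/-!
# Shift-coupling locality (X2): the measurable / deterministic reduction to hull stability
(line `qkz-strip-boundary-arm` of crux `CardyComplexCone.EdgePrecompact`, stmt-CriticalPhenomena-11387)

The registered stub `stub_shiftCouplingLocality` (X2, reshape r1; consumed by the landed reduction
`shiftStability_of : X1 → X2 → ShiftStability` of
`Theorems/CardyComplexConeEdgePrecompactShiftStabilityReduction.lean`) asks, along a discretisation
family `Λ` of a Dobrushin domain `D`, on a compact `K` with `cthickening (2ρ) K ⊆ D`, for every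
`ε > 0`: some `η > 0` such that eventually in `δ`, for every corner `(v,f)` with `δv ∈ K` and every
lattice vector `w` with `‖δw‖ < η`, there is an event `B`, measurable with respect to the configuration
OFF the ball `B(δv, ρ)` (`MeasurableSpace.comap (fun ω ↦ ω \ I) _`, `I` = the pairs whose medial point
lies in the open ball), with `P_{1/2}(B) ≤ ε` and
`E[F⁰] − E[F¹] = E[F⁰ ; B] − E[F¹ ; B]`, where `F⁰_ω = dartPhaseSum (medialExploration (Λ δ) ω) δ (1/3) (v,f)`
is the integrand of the corner observable of the datum `Λ δ` and `F¹` the same for the translated datum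
`shiftData (Λ δ) w` (domain and arcs moved by `δw`, SAME configuration `ω`).

This file proves the whole measurable / deterministic half of X2 and isolates its probabilistic
half as ONE inline hypothesis (registered sub-goal `shiftCouplingLocality_of_hullStability`):

1. THE EVENT. `B := {ω | ∃ ω', ω' \ I = ω \ I ∧ ¬ PassageAgree ω'}` — the EXTERIOR PROJECTION of the
   (phase-free) passage-disagreement set, where `PassageAgree ω'` says that the two explorations
   `γ⁰ = medialExploration (Λ δ) ω'`, `γ¹ = medialExploration (shiftData (Λ δ) w) ω'` traverse the dart
   `(v,f)` with the same set of prefix windings: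
   `∀ W, (∃ k, γ⁰[k] = cornerSource v f ∧ γ⁰[k+1] = cornerTarget v f ∧ winding (γ⁰[0..k+1]) = W) ↔ (same for γ¹)`.
   Since an exploration path traverses a dart at most once (`card_filter_dart_le_one`), this is
   "same passage status and, on passage, same winding" — exactly the quantity the phase `exp(−iW/3)`
   of `dartPhaseSum` reads (`dartPhaseSum_eq_of_passage_iff`); bare passage-sharing is NOT enough
   (`±2π` slips, `Cruxes/EdgePrecompact/ShiftCouplingWindingOffsetCex.md`), winding equality is.
2. MEASURABILITY. Both explorations read `ω` only through the finitely many edges of the two bounded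
   discrete domains (`medialExploration_inter_eq`, `finite_edgeSet_discreteDomainGraph`), so `B` is a
   finite-cylinder event (`DeterminedBy.measurableSet_of_finset`), and `(ω \ I) \ I = ω \ I` makes it
   its own preimage under the exterior restriction: `B` is exterior-measurable
   (`measurableSet_comap_exteriorProjection`). The phase sums are measurable and bounded by `1`, hence
   integrable (`integrable_dartPhaseSum_medialExploration`).
3. THE IDENTITY. Off `B` (take `ω' = ω`) the passages agree, so `F⁰ = F¹` pointwise off `B` and
   `E[F⁰] − E[F¹] = E[F⁰ − F¹ ; B] + E[0 ; Bᶜ] = E[F⁰ ; B] − E[F¹ ; B]` (`integral_sub_eq_setIntegral_sub`).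
4. WHAT IS LEFT (the hypothesis, "HULL STABILITY", purely probabilistic, no phase): with the same
   quantifier prefix as X2, `P_{1/2}(B) ≤ ε` — the exterior configuration alone forces, for EVERY filling
   of the ball, the explorations of `Λ δ` and of its translate by `δw` to pass the dart `(v,f)` alike
   with equal windings, except on a set of probability `≤ ε`, uniformly over corners `δv ∈ K` and shifts
   `‖δw‖ < η`, eventually in `δ`. Planner's route to it (sibling card `shift-coupling-phase-exact`):
   boundary-pivotality of the `η`-collar of `∂D` for the hull down to distance `≥ 2ρ − η` from it
   (half-plane three-arm sums over the collar, exponent `2 > 1`), marked-point re-rooting near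
   `a_δ, b_δ` (half-plane two-arm; the source of the `2π` offsets), RSW merging — bond-`ℤ²` RSW/arm
   technology, partly unported and delicate for rough Jordan boundaries. It is NOT proved here.

References: S. Smirnov, Ann. of Math. 172 (2010), §2.2 (winding of the exploration path, no medial
edge used twice); H. Duminil-Copin, S. Smirnov, *Conformal invariance of lattice models*,
arXiv:1109.1549, §8.3.1 (the `q = 1`, spin-`1/3` edge observable); G. Grimmett, *Percolation*, 2nd
ed. (1999), §2.2 (cylinder events), §11.2 (medial lattice of `ℤ²`).
(buildfix 2026-08-20: comment-only re-land to re-enqueue the module build after its blocking imports were repaired; no declaration changed.)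
-/

namespace Summit.CriticalPhenomena.CardyFormulaZ2.Cruxes.EdgePrecompact.QkzStripBoundaryArm

open MeasureTheory Filter Set Metric
open scoped Topology BigOperators Pointwise
open Literature.Probability.LatticeModels Literature.Probability.Percolation
open Literature.Probability.RandomPlanarGeometry (DobrushinDomain)
open Summit.CriticalPhenomena.CardyFormulaZ2.Theses.CardyComplexCone
-- buildfix lane 2026-08-20: the short name `winding` became ambiguous after the 2026-08-15 Literature
-- migration (`LatticeModels.winding` of `FermionicObservable` vs `Polyline.winding`, both in the cone);
-- this namespace-local alias makes it resolve, as in the accepted build and as the consumers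
-- (`…HullStabilityReduction`, `…ChainAt`) spell it, to `Polyline.winding`. No declaration text changes.
export Literature.Probability.LatticeModels.Polyline (winding)

noncomputable section

/-! ## The exploration path reads only the (finitely many) edges of `Ω_δ` -/

-- adapted from `finite_edgeSet_discreteDomainGraph` of
-- Literature/Probability/Percolation/FourArmGarbanOrthogonality.lean (not imported: heavy cone)
/-- The discrete domain `Ω_δ` of a bounded domain at positive mesh has finitely many edges (every
edge joins two sites of the finite set `meshDomain Ω δ`). -/
theorem finite_edgeSet_discreteDomainGraph {Ω : Set ℂ} {δ : ℝ} (hΩ : Bornology.IsBounded Ω)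
    (hδ : 0 < δ) : (discreteDomainGraph Ω δ).edgeSet.Finite := by
  have hfin := meshDomain_finite hΩ hδ
  refine ((hfin.prod hfin).image fun p : Site 2 × Site 2 => s(p.1, p.2)).subset ?_
  intro e he
  induction e using Sym2.ind with
  | h x y =>
    obtain ⟨-, hx, hy⟩ := discreteDomainGraph_adj_iff.1 ((SimpleGraph.mem_edgeSet _).1 he)
    exact ⟨(x, y), ⟨hx, hy⟩, rfl⟩

/-- **The exploration path reads only the edges of `Ω_δ`**: `medialExploration E (ω ∩ S) =
medialExploration E ω` for every set `S` of pairs containing them. Indeed the completed configuration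
`E.bcBondConfig ω` reads only those edges, exploration paths depend on `ω` only through it (the only
field of `IsMedialExploration` mentioning `ω` is the turning rule), and so does the chosen path (junk
branch `[]` included). (The three steps are the lemmas `bcBondConfig_inter_eq`,
`isMedialExploration_congr`, `medialExploration_congr` of `Theorems/LagHandOff/Negative/Structure.lean`,
inlined here so as not to import that route's cone.) -/
theorem medialExploration_inter_eq (E : DiscreteDobrushin) {S : Set (Sym2 (Site 2))}
    (hS : (discreteDomainGraph E.Ω E.δ).edgeSet ⊆ S) (ω : BondConfig (Site 2)) :
    medialExploration E (ω ∩ S) = medialExploration E ω := by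
  -- the completed configuration reads only the edges of `Ω_δ`
  have hbc : E.bcBondConfig (ω ∩ S) = E.bcBondConfig ω := by
    ext e
    simp only [DiscreteDobrushin.mem_bcBondConfig_iff, Set.mem_inter_iff]
    constructor
    · rintro ⟨he, h | ⟨⟨hω, -⟩, hB⟩⟩
      · exact ⟨he, Or.inl h⟩
      · exact ⟨he, Or.inr ⟨hω, hB⟩⟩
    · rintro ⟨he, h | ⟨hω, hB⟩⟩
      · exact ⟨he, Or.inl h⟩
      · exact ⟨he, Or.inr ⟨⟨hω, hS he⟩, hB⟩⟩
  -- hence the same lists are exploration paths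
  have hiff : ∀ γ, IsMedialExploration E (ω ∩ S) γ ↔ IsMedialExploration E ω γ := fun γ =>
    ⟨fun hγ => { ne_nil := hγ.ne_nil, step := hγ.step, turn := hbc ▸ hγ.turn, nodup := hγ.nodup,
                 head_mem := hγ.head_mem, getLast_mem := hγ.getLast_mem,
                 head_ne_getLast := hγ.head_ne_getLast, start := hγ.start },
     fun hγ => { ne_nil := hγ.ne_nil, step := hγ.step, turn := hbc.symm ▸ hγ.turn, nodup := hγ.nodup,
                 head_mem := hγ.head_mem, getLast_mem := hγ.getLast_mem,
                 head_ne_getLast := hγ.head_ne_getLast, start := hγ.start }⟩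
  -- and the chosen path is the same (unique path, or junk `[]`, on both sides)
  by_cases hex : ∃! γ, IsMedialExploration E (ω ∩ S) γ
  · obtain ⟨γ, hγ, huniq⟩ := id hex
    have hγ' : IsMedialExploration E ω γ := (hiff γ).1 hγ
    have hex' : ∃! γ', IsMedialExploration E ω γ' :=
      ⟨γ, hγ', fun γ' h' => huniq γ' ((hiff γ').2 h')⟩
    rw [medialExploration_eq_of_existsUnique hex hγ, medialExploration_eq_of_existsUnique hex' hγ']
  · have hex' : ¬ ∃! γ', IsMedialExploration E ω γ' := fun ⟨γ, hγ, huniq⟩ =>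
      hex ⟨γ, (hiff γ).2 hγ, fun γ' h' => huniq γ' ((hiff γ').1 h')⟩
    rw [medialExploration_eq_nil hex, medialExploration_eq_nil hex']

/-! ## Finite dependence gives measurability; the phase sums are integrable -/

/-- A function of the configuration reading only the pairs of a FINITE set `A` is measurable, for
every σ-algebra on its target: each fibre is a finite-cylinder event (Grimmett 1999, §2.2). -/
theorem measurable_of_forall_eq_inter {β : Type*} [MeasurableSpace β]
    {φ : BondConfig (Site 2) → β} {A : Set (Sym2 (Site 2))} (hA : A.Finite)
    (h : ∀ ω, φ ω = φ (ω ∩ A)) : Measurable φ := by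
  intro s _
  refine DeterminedBy.measurableSet_of_finset (F := hA.toFinset) ?_
  rw [determinedBy_iff, Set.Finite.coe_toFinset]
  intro ω ω' hωω'
  rw [Set.mem_preimage, Set.mem_preimage, h ω, h ω', hωω']

/-- The integrand `ω ↦ dartPhaseSum (medialExploration E ω) δ σ c` of the dart observable of admissible
data is measurable (it reads only the finitely many edges of `Ω_δ`). -/
theorem measurable_dartPhaseSum_medialExploration {E : DiscreteDobrushin} (hE : E.IsZdAdmissible)
    (δ σ : ℝ) (c : Site 2 × Site 2) :
    Measurable fun ω : BondConfig (Site 2) => dartPhaseSum (medialExploration E ω) δ σ c :=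
  measurable_of_forall_eq_inter (finite_edgeSet_discreteDomainGraph hE.isBounded hE.delta_pos)
    fun ω => by rw [medialExploration_inter_eq E subset_rfl ω]

/-- … and integrable under `P_{1/2}` (measurable and bounded by `1`, `norm_dartPhaseSum_le_one`). -/
theorem integrable_dartPhaseSum_medialExploration {E : DiscreteDobrushin} (hE : E.IsZdAdmissible)
    (δ σ : ℝ) (c : Site 2 × Site 2) :
    Integrable (fun ω : BondConfig (Site 2) => dartPhaseSum (medialExploration E ω) δ σ c)
      (bondPercolation (zdGraph 2) half) :=
  Integrable.of_bound (measurable_dartPhaseSum_medialExploration hE δ σ c).aestronglyMeasurable 1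
    (Eventually.of_forall fun ω =>
      norm_dartPhaseSum_le_one (nodup_zip_tail_medialExploration E ω) δ σ c)

/-! ## The pathwise lemma: equal passage windings give equal phase sums -/

/-- For a path repeating no medial edge, a traversal of the dart `c` at position `k` is its only one,
and the phase sum is the single phase `exp (−iσ W_k)`. -/
theorem dartPhaseSum_eq_exp_of_passage {γ : List MedialVertex} (hγ : (γ.zip γ.tail).Nodup)
    (δ σ : ℝ) (c : Site 2 × Site 2) {k : ℕ} (hs : γ[k]? = some (cornerSource c.1 c.2))
    (ht : γ[k + 1]? = some (cornerTarget c.1 c.2)) :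
    dartPhaseSum γ δ σ c =
      Complex.exp (-Complex.I * σ * (winding ((γ.map (medialPoint δ)).take (k + 2)) : ℝ)) := by
  unfold dartPhaseSum
  have hk : k ∈ (Finset.range γ.length).filter
      (fun k => γ[k]? = some (cornerSource c.1 c.2) ∧ γ[k + 1]? = some (cornerTarget c.1 c.2)) := by
    rw [Finset.mem_filter, Finset.mem_range]
    exact ⟨(List.getElem?_eq_some_iff.1 hs).1, hs, ht⟩
  rw [Finset.eq_singleton_iff_unique_mem.2 ⟨hk, fun j hj =>
    Finset.card_le_one.1 (card_filter_dart_le_one hγ _ _) j hj k hk⟩, Finset.sum_singleton]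

/-- A path never traversing the dart `c` contributes nothing. -/
theorem dartPhaseSum_eq_zero_of_forall_not {γ : List MedialVertex} (δ σ : ℝ) (c : Site 2 × Site 2)
    (h : ∀ k : ℕ, ¬ (γ[k]? = some (cornerSource c.1 c.2) ∧ γ[k + 1]? = some (cornerTarget c.1 c.2))) :
    dartPhaseSum γ δ σ c = 0 :=
  Finset.sum_eq_zero fun k hk => absurd (Finset.mem_filter.1 hk).2 (h k)

/-- **Pathwise lemma.** Two paths repeating no medial edge which traverse the dart `c` with the same
set of prefix windings (`∀ W, (∃ traversal of c by γ₀ with winding W) ↔ (∃ … by γ₁ …)`) have the same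
phase sum at `c` — for every spin `σ`. (Bare "both traverse `c`" is not enough: the windings may differ
by `±2π`, `ShiftCouplingWindingOffsetCex.md`.) -/
theorem dartPhaseSum_eq_of_passage_iff {γ₀ γ₁ : List MedialVertex} (h₀ : (γ₀.zip γ₀.tail).Nodup)
    (h₁ : (γ₁.zip γ₁.tail).Nodup) (δ σ : ℝ) (c : Site 2 × Site 2)
    (h : ∀ W : ℝ,
      (∃ k : ℕ, γ₀[k]? = some (cornerSource c.1 c.2) ∧ γ₀[k + 1]? = some (cornerTarget c.1 c.2) ∧
          winding ((γ₀.map (medialPoint δ)).take (k + 2)) = W) ↔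
        (∃ k : ℕ, γ₁[k]? = some (cornerSource c.1 c.2) ∧ γ₁[k + 1]? = some (cornerTarget c.1 c.2) ∧
          winding ((γ₁.map (medialPoint δ)).take (k + 2)) = W)) :
    dartPhaseSum γ₀ δ σ c = dartPhaseSum γ₁ δ σ c := by
  by_cases hex : ∃ k : ℕ, γ₀[k]? = some (cornerSource c.1 c.2) ∧ γ₀[k + 1]? = some (cornerTarget c.1 c.2)
  · obtain ⟨k, hs, ht⟩ := hex
    obtain ⟨k', hs', ht', hW⟩ := (h _).1 ⟨k, hs, ht, rfl⟩
    rw [dartPhaseSum_eq_exp_of_passage h₀ δ σ c hs ht,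
      dartPhaseSum_eq_exp_of_passage h₁ δ σ c hs' ht', hW]
  · have hex' : ∀ k : ℕ,
        ¬ (γ₁[k]? = some (cornerSource c.1 c.2) ∧ γ₁[k + 1]? = some (cornerTarget c.1 c.2)) :=
      fun k' hk' => by
        obtain ⟨k, hs, ht, -⟩ := (h _).2 ⟨k', hk'.1, hk'.2, rfl⟩
        exact hex ⟨k, hs, ht⟩
    rw [dartPhaseSum_eq_zero_of_forall_not δ σ c fun k hk => hex ⟨k, hk⟩,
      dartPhaseSum_eq_zero_of_forall_not δ σ c hex']

/-! ## Exterior projections of finite-cylinder events -/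

/-- The EXTERIOR PROJECTION `{ω | ∃ ω', ω' \ I = ω \ I ∧ Dis ω'}` ("some filling of `I` produces `Dis`")
of a property `Dis` reading only the pairs of a finite set `A` is a finite-cylinder event, hence
measurable: it is determined by the pairs of `A` (glue the `I`-part of a witness to the exterior of a
configuration agreeing on `A`). (Grimmett 1999, §2.2.) -/
theorem measurableSet_exteriorProjection {Dis : BondConfig (Site 2) → Prop}
    {A : Set (Sym2 (Site 2))} (hA : A.Finite) (hDis : ∀ ω, Dis ω ↔ Dis (ω ∩ A))
    (I : Set (Sym2 (Site 2))) :
    MeasurableSet {ω : BondConfig (Site 2) | ∃ ω', ω' \ I = ω \ I ∧ Dis ω'} := by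
  refine DeterminedBy.measurableSet_of_finset (F := hA.toFinset) ?_
  rw [determinedBy_iff, Set.Finite.coe_toFinset]
  suffices key : ∀ ω₁ ω₂ : BondConfig (Site 2), ω₁ ∩ A = ω₂ ∩ A →
      ω₁ ∈ {ω : BondConfig (Site 2) | ∃ ω', ω' \ I = ω \ I ∧ Dis ω'} →
      ω₂ ∈ {ω : BondConfig (Site 2) | ∃ ω', ω' \ I = ω \ I ∧ Dis ω'} from
    fun ω₁ ω₂ h => ⟨key ω₁ ω₂ h, key ω₂ ω₁ h.symm⟩
  rintro ω₁ ω₂ h ⟨ω', hω', hD⟩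
  have hA' : ∀ e ∈ A, e ∈ ω₁ ↔ e ∈ ω₂ := fun e he => by
    simpa [Set.mem_inter_iff, he] using Set.ext_iff.1 h e
  have hI' : ∀ e ∉ I, e ∈ ω' ↔ e ∈ ω₁ := fun e he => by
    simpa [Set.mem_sdiff, he] using Set.ext_iff.1 hω' e
  refine ⟨(ω' ∩ I) ∪ (ω₂ \ I), ?_, ?_⟩
  · ext e
    simp only [Set.mem_sdiff, Set.mem_union, Set.mem_inter_iff]
    tauto
  · rw [hDis] at hD ⊢
    have hset : ((ω' ∩ I) ∪ (ω₂ \ I)) ∩ A = ω' ∩ A := by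
      ext e
      simp only [Set.mem_inter_iff, Set.mem_union, Set.mem_sdiff]
      constructor
      · rintro ⟨h1 | ⟨h2, h3⟩, heA⟩
        · exact ⟨h1.1, heA⟩
        · exact ⟨(hI' e h3).2 ((hA' e heA).2 h2), heA⟩
      · rintro ⟨h1, heA⟩
        by_cases heI : e ∈ I
        · exact ⟨Or.inl ⟨h1, heI⟩, heA⟩
        · exact ⟨Or.inr ⟨(hA' e heA).1 ((hI' e heI).1 h1), heI⟩, heA⟩
    rwa [hset]

/-- … and it is measurable with respect to the configuration OFF `I`
(`MeasurableSpace.comap (fun ω ↦ ω \ I) _`): it is its own preimage under `ω ↦ ω \ I`. -/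
theorem measurableSet_comap_exteriorProjection {Dis : BondConfig (Site 2) → Prop}
    {A : Set (Sym2 (Site 2))} (hA : A.Finite) (hDis : ∀ ω, Dis ω ↔ Dis (ω ∩ A))
    (I : Set (Sym2 (Site 2))) :
    MeasurableSet[MeasurableSpace.comap (fun ω : BondConfig (Site 2) => ω \ I)
      (inferInstance : MeasurableSpace (BondConfig (Site 2)))]
      {ω : BondConfig (Site 2) | ∃ ω', ω' \ I = ω \ I ∧ Dis ω'} := by
  refine MeasurableSpace.measurableSet_comap.2 ⟨_, measurableSet_exteriorProjection hA hDis I, ?_⟩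
  ext ω
  simp only [Set.mem_preimage, Set.mem_setOf_eq, sdiff_idem]

/-- Splitting two expectations along an event off which the integrands agree:
`E[F₀] − E[F₁] = E[F₀ ; B] − E[F₁ ; B]`. -/
theorem integral_sub_eq_setIntegral_sub {α : Type*} [MeasurableSpace α] {μ : Measure α}
    {F₀ F₁ : α → ℂ} (h₀ : Integrable F₀ μ) (h₁ : Integrable F₁ μ) {B : Set α}
    (hB : MeasurableSet B) (hoff : ∀ ω, ω ∉ B → F₀ ω = F₁ ω) :
    (∫ ω, F₀ ω ∂μ) - (∫ ω, F₁ ω ∂μ) = (∫ ω in B, F₀ ω ∂μ) - (∫ ω in B, F₁ ω ∂μ) := by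
  have hcompl : ∫ ω in Bᶜ, (F₀ ω - F₁ ω) ∂μ = 0 :=
    setIntegral_eq_zero_of_forall_eq_zero fun ω hω => sub_eq_zero.2 (hoff ω hω)
  calc (∫ ω, F₀ ω ∂μ) - (∫ ω, F₁ ω ∂μ) = ∫ ω, (F₀ ω - F₁ ω) ∂μ := (integral_sub h₀ h₁).symm
    _ = (∫ ω in B, (F₀ ω - F₁ ω) ∂μ) + ∫ ω in Bᶜ, (F₀ ω - F₁ ω) ∂μ :=
        (integral_add_compl (f := fun ω => F₀ ω - F₁ ω) hB (h₀.sub h₁)).symm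
    _ = (∫ ω in B, F₀ ω ∂μ) - (∫ ω in B, F₁ ω ∂μ) := by
        rw [hcompl, add_zero, integral_sub h₀.integrableOn h₁.integrableOn]

/-! ## The reduction -/

/-- **Shift-coupling locality (X2) from hull stability** (registered sub-goal
`shiftCouplingLocality_of_hullStability` of stmt-CriticalPhenomena-11387; its conclusion is VERBATIM the
registered stub `stub_shiftCouplingLocality`).

HYPOTHESIS (HULL STABILITY — the purely probabilistic, phase-free half of X2, stated inline): along a
discretisation family `Λ` of `D` (`(Λ δ).Ω = D`, mesh `δ`, eventually admissible), on a compact `K` with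
`cthickening (2ρ) K ⊆ D`, for every `ε > 0` there is `η > 0` such that eventually in `δ`, for every
corner `(v,f)` with `δv ∈ K` and every `w` with `‖δw‖ < η`, the event
"some configuration `ω'` agreeing with `ω` off `I = {e | medialPoint δ e ∈ ball (δv) ρ}` makes the
explorations of `Λ δ` and of `shiftData (Λ δ) w` traverse the dart `(v,f)` with different sets of prefix
windings" has `P_{1/2}`-probability `≤ ε`.

CONCLUSION (X2): that very event is the required `B` — exterior-measurable
(`measurableSet_comap_exteriorProjection`, the explorations reading only the finitely many edges of the
two bounded discrete domains), of probability `≤ ε` (the hypothesis), and carrying the difference of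
the expectations (`dartPhaseSum_eq_of_passage_iff` off `B`, `integral_sub_eq_setIntegral_sub`). -/
theorem shiftCouplingLocality_of_hullStability : (∀ (D : DobrushinDomain) (Λ : ℝ → DiscreteDobrushin), (∀ δ, (Λ δ).Ω = D.carrier) → (∀ δ, (Λ δ).δ = δ) → (∀ᶠ δ in nhdsWithin (0:ℝ) (Set.Ioi 0), (Λ δ).IsZdAdmissible) → ∀ K : Set ℂ, IsCompact K → K ⊆ D.carrier → ∀ ρ > (0:ℝ), cthickening (2 * ρ) K ⊆ D.carrier → ∀ ε > (0:ℝ), ∃ η > (0:ℝ), ∀ᶠ δ in nhdsWithin (0:ℝ) (Set.Ioi 0), ∀ v f w : Site 2, IsCorner v f → meshPoint δ v ∈ K → ‖meshPoint δ w‖ < η → (bondPercolation (zdGraph 2) half).real {ω : BondConfig (Site 2) | ∃ ω' : BondConfig (Site 2), ω' \ {e | medialPoint δ e ∈ ball (meshPoint δ v) ρ} = ω \ {e | medialPoint δ e ∈ ball (meshPoint δ v) ρ} ∧ ¬ ∀ W : ℝ, (∃ k : ℕ, (medialExploration (Λ δ) ω')[k]? = some (cornerSource v f) ∧ (medialExploration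 (Λ δ) ω')[k + 1]? = some (cornerTarget v f) ∧ winding (((medialExploration (Λ δ) ω').map (medialPoint δ)).take (k + 2)) = W) ↔ (∃ k : ℕ, (medialExploration (shiftData (Λ δ) w) ω')[k]? = some (cornerSource v f) ∧ (medialExploration (shiftData (Λ δ) w) ω')[k + 1]? = some (cornerTarget v f) ∧ winding (((medialExploration (shiftData (Λ δ) w) ω').map (medialPoint δ)).take (k + 2)) = W)} ≤ ε) → ∀ (D : DobrushinDomain) (Λ : ℝ → DiscreteDobrushin), (∀ δ, (Λ δ).Ω = D.carrier) → (∀ δ, (Λ δ).δ = δ) → (∀ᶠ δ in nhdsWithin (0:ℝ) (Set.Ioi 0), (Λ δ).IsZdAdmissible) → ∀ K : Set ℂ, IsCompact K → K ⊆ D.carrier → ∀ ρ > (0:ℝ), cthickening (2 * ρ) K ⊆ D.carrier → ∀ ε > (0:ℝ), ∃ η > (0:ℝ), ∀ᶠ δ in nhdsWithin (0:ℝ) (Set.Ioi 0), ∀ v f w : Site 2, IsCorner v f → meshPoint δ v ∈ K → ‖meshPoint δ w‖ < η → ∃ B : Set (BondConfig (Site 2)), MeasurableSet[MeasurableSpace.comap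 (fun ω : BondConfig (Site 2) => ω \ {e | medialPoint δ e ∈ ball (meshPoint δ v) ρ}) (inferInstance : MeasurableSpace (BondConfig (Site 2)))] B ∧ (bondPercolation (zdGraph 2) half).real B ≤ ε ∧ (∫ ω, dartPhaseSum (medialExploration (Λ δ) ω) δ (1 / 3) (v, f) ∂(bondPercolation (zdGraph 2) half)) - (∫ ω, dartPhaseSum (medialExploration (shiftData (Λ δ) w) ω) δ (1 / 3) (v, f) ∂(bondPercolation (zdGraph 2) half)) = (∫ ω in B, dartPhaseSum (medialExploration (Λ δ) ω) δ (1 / 3) (v, f) ∂(bondPercolation (zdGraph 2) half)) - (∫ ω in B, dartPhaseSum (medialExploration (shiftData (Λ δ) w) ω) δ (1 / 3) (v, f) ∂(bondPercolation (zdGraph 2) half)) := by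
  intro hHS D Λ hΩ hδ hadm K hK hKD ρ hρ hρK ε hε
  obtain ⟨η, hη, hev⟩ := hHS D Λ hΩ hδ hadm K hK hKD ρ hρ hρK ε hε
  refine ⟨η, hη, ?_⟩
  filter_upwards [hev, hadm] with δ hevδ hadmδ
  intro v f w hvf hvK hw
  have hPB := hevδ v f w hvf hvK hw
  -- the interior pairs of the ball and the disagreement property
  set I : Set (Sym2 (Site 2)) := {e | medialPoint δ e ∈ ball (meshPoint δ v) ρ} with hI_def
  set Dis : BondConfig (Site 2) → Prop := fun ω' => ¬ ∀ W : ℝ,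
      (∃ k : ℕ, (medialExploration (Λ δ) ω')[k]? = some (cornerSource v f) ∧
          (medialExploration (Λ δ) ω')[k + 1]? = some (cornerTarget v f) ∧
          winding (((medialExploration (Λ δ) ω').map (medialPoint δ)).take (k + 2)) = W) ↔
        (∃ k : ℕ, (medialExploration (shiftData (Λ δ) w) ω')[k]? = some (cornerSource v f) ∧
          (medialExploration (shiftData (Λ δ) w) ω')[k + 1]? = some (cornerTarget v f) ∧
          winding (((medialExploration (shiftData (Λ δ) w) ω').map (medialPoint δ)).take (k + 2)) = W)
    with hDis_def
  -- the finitely many edges read by the two explorations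
  have hadm₁ : (shiftData (Λ δ) w).IsZdAdmissible := isZdAdmissible_shiftData _ _ hadmδ
  set A : Set (Sym2 (Site 2)) := (discreteDomainGraph (Λ δ).Ω (Λ δ).δ).edgeSet ∪
    (discreteDomainGraph (shiftData (Λ δ) w).Ω (shiftData (Λ δ) w).δ).edgeSet with hA_def
  have hAfin : A.Finite :=
    (finite_edgeSet_discreteDomainGraph hadmδ.isBounded hadmδ.delta_pos).union
      (finite_edgeSet_discreteDomainGraph hadm₁.isBounded hadm₁.delta_pos)
  have hmE₀ : ∀ ω, medialExploration (Λ δ) (ω ∩ A) = medialExploration (Λ δ) ω := fun ω =>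
    medialExploration_inter_eq (Λ δ) (by rw [hA_def]; exact subset_union_left) ω
  have hmE₁ : ∀ ω, medialExploration (shiftData (Λ δ) w) (ω ∩ A) =
      medialExploration (shiftData (Λ δ) w) ω := fun ω =>
    medialExploration_inter_eq (shiftData (Λ δ) w) (by rw [hA_def]; exact subset_union_right) ω
  have hDisA : ∀ ω, Dis ω ↔ Dis (ω ∩ A) := fun ω => by
    simp only [hDis_def]
    rw [hmE₀ ω, hmE₁ ω]
  -- the event: exterior projection of the passage-disagreement set
  refine ⟨{ω | ∃ ω', ω' \ I = ω \ I ∧ Dis ω'}, measurableSet_comap_exteriorProjection hAfin hDisA I,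
    hPB, ?_⟩
  refine integral_sub_eq_setIntegral_sub
    (integrable_dartPhaseSum_medialExploration hadmδ δ (1 / 3) (v, f))
    (integrable_dartPhaseSum_medialExploration hadm₁ δ (1 / 3) (v, f))
    (measurableSet_exteriorProjection hAfin hDisA I) fun ω hω => ?_
  -- off the event the passages agree (take `ω' = ω`), hence so do the phase sums
  exact dartPhaseSum_eq_of_passage_iff (nodup_zip_tail_medialExploration _ _)
    (nodup_zip_tail_medialExploration _ _) δ (1 / 3) (v, f)
    (not_not.1 fun hcon => hω ⟨ω, rfl, hcon⟩)

end

end Summit.CriticalPhenomena.CardyFormulaZ2.Cruxes.EdgePrecompact.QkzStripBoundaryArm
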